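import Literature.NumberTheory.Automorphic.UnitaryGroupCohomologicalFormsConjRep
import Literature.NumberTheory.Automorphic.GKModules
import Mathlib.Analysis.Calculus.Deriv.Star
import HarnessLib

/-!
# Crux `H413` — RUNG 1½ «ISOTYPY FROM A NULL CORE», brick B6a (generic `(𝔤, K)` algebra): the conjugate of a `(𝔤, K)`-module —
# the `(𝔤, K)` axioms, irreducibility and admissibility pass to `V̄ = ConjVec V`

Floor-0 programme P3 «U3-mult», seat F0P3-p01 (g4); crux item stmt-HodgeConjecture-24833 (`HCCMUnconditional.H413`); consumer ★-pending
`Theorems/F0P3ArchIsotypyConj` (letter F1a invariant under `P ↦ P̄` ⇒ the antiholomorphic half of `stub_F1a_cm`).  HC_CM is proved only modulo the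
printed citations until rung 0 closes.  GENERIC CONTENT (no automorphic object occurs): THEOREMS only (no definition, no named fact, no
instance, no `sorry`), over the tree's ★ `ConjVec V` ∕ `toConj : V ≃ₛₗ[starRingEnd ℂ] ConjVec V` ∕ `ConjVec.conjRep` (★ `HarishChandraGLConj`:
the conjugate complex structure `c ·̄ v = c̄ · v` and the conjugate of a real Lie algebra representation) and ★ `ConjVec.repConj` (★
`UnitaryGroupCohomologicalFormsConjRep`: the conjugate of a group representation, `isIrreducible_repConj_iff`), for the `(𝔤, K)`-module
vocabulary of ★ `GKModules` (`IsGKModule`, `IsGKSubmodule`, `IsIrreducibleGK`, `IsAdmissibleGK`).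

THE MATHEMATICS.  Let `(ρK, ρ𝔤)` be `(𝔤, K)`-module data for a linear real group `G` on a complex vector space `M`, and let
`e : M → M'` be a CONJUGATE-LINEAR bijection onto a complex vector space `M'` carrying actions `(ρK', ρ𝔤')` with `ρK' k ∘ e = e ∘ ρK k`,
`ρ𝔤' X ∘ e = e ∘ ρ𝔤 X` — the situation of the complex conjugate `V̄` of a `(𝔤, K)`-module (`e = toConj`, same operators) and of the complex
conjugate `π̄ = {f̄ : f ∈ π}` of an automorphic representation, on which `K` and the REAL Lie algebra `𝔤` act through `k·f̄ = \overline{k·f}`,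
`X·f̄ = \overline{X·f}` ([Clozel1990, §3.1]: `^cπ`; [BorelWallach2000, VII 2.10]; [KnappVogan1995, §VI.2 (conjugate modules)]).  Then:

* §1 `isGKModule_of_conjSemilinear` — `(ρK', ρ𝔤')` satisfy the `(𝔤, K)` axioms (★ `IsGKModule`): `K`-finiteness (spans are transported by the
  semilinear `e`, ★ `Submodule.FG.map`), weak continuity and the weak derivative along `𝔨` (a functional `ℓ'` on `M'` gives the functional
  `m ↦ \overline{ℓ'(e m)}` on `M`; `t ↦ \overline{φ(t)}` has derivative `\overline{φ'(t)}`, ★ `HasDerivAt.star`), `Ad`-compatibility (same operators).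
* §2 `isGKSubmodule_comap_conjSemilinear`, `isIrreducibleGK_of_conjSemilinear` — `(𝔤, K)`-submodules correspond under `e`, so irreducibility passes.
* §3 `isAdmissibleGK_of_conjSemilinear` — admissibility passes: for an irreducible finite-dimensional `K`-type `τ` on `W`, the map
  `f ↦ e⁻¹ ∘ f ∘ toConj⁻¹` is an injective REAL-linear map `Hom_K(τ, ρK') → Hom_K(τ̄, ρK)` (`τ̄ = repConj τ` irreducible on the
  finite-dimensional `W̄`), and `Hom_K(τ̄, ρK)` is finite-dimensional by the admissibility of `ρK`.
* §4 The instances for `V̄ = ConjVec V` with `(repConj ρK, conjRep ρ𝔤)`: `conjVec_finiteDimensional`, `isGKModule_repConj`,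
  `isIrreducibleGK_repConj`, `isAdmissibleGK_repConj` (and the converses via `toConj.symm`).

Consumed by ★-pending `Theorems/F0P3ArchIsotypyConj` (road «F1a in-house at the pin»): the archimedean-isotypy letter F1a for a discrete
automorphic `P` of ANTIholomorphic type follows from the holomorphic case applied to `P̄` once the irreducible admissible module `M` of `P̄` is
replaced by `M̄`.  `--supports stmt-HodgeConjecture-24833`.

## References
* [KnappVogan1995] A. W. Knapp, D. A. Vogan, *Cohomological Induction and Unitary Representations* (1995), §VI.2 (Hermitian duals and conjugate
  modules), §I.3–I.4.
* [BorelWallach2000] A. Borel, N. Wallach, 2nd ed. (2000), 0 §2.5; VII 2.10.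
* [Clozel1990] L. Clozel, *Motifs et formes automorphes* (1990), §3.1.
-/

-- Mathlib idiom (Mathlib/Algebra/Lie/OfAssociative.lean; as in ★ `GKModules`): the commutator bracket on `Module.End ℂ V`,
-- needed to MENTION `G.lie →ₗ⁅ℝ⁆ Module.End ℂ _`.
attribute [local instance 100] LieRing.ofAssociativeRing

set_option autoImplicit false
-- the mandated namespace repeats `HodgeConjecture.HodgeConjecture`, as in every `Theorems/*.lean` of this sub-problem
set_option linter.dupNamespace false

namespace Summit.HodgeConjecture.HodgeConjecture.Cruxes.H413.F0P3GKModuleConjVec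

open Literature.NumberTheory.Automorphic Literature.NumberTheory.Automorphic.ConjVec

/-! ## §0 Two pieces of conjugate-linear algebra -/

section Algebra

variable {M M' : Type*} [AddCommGroup M] [Module ℂ M] [AddCommGroup M'] [Module ℂ M']

/-- A complex-linear functional `ℓ'` on the target of a conjugate-linear bijection `e` gives the complex-linear functional
`m ↦ \overline{ℓ'(e m)}` on the source: `ℓ'(e m) = \overline{ℓ m}`. [folklore] -/
theorem exists_dual_conjSemilinear (e : M ≃ₛₗ[starRingEnd ℂ] M') (ℓ' : Module.Dual ℂ M') :
    ∃ ℓ : Module.Dual ℂ M, ∀ m : M, ℓ' (e m) = starRingEnd ℂ (ℓ m) := by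
  refine ⟨{ toFun := fun m => starRingEnd ℂ (ℓ' (e m))
            map_add' := fun x y => by simp only [map_add]
            map_smul' := fun c x => by
              simp only [LinearEquiv.map_smulₛₗ, map_smul, smul_eq_mul, map_mul, starRingEnd_self_apply,
                RingHom.id_apply] }, fun m => ?_⟩
  change ℓ' (e m) = starRingEnd ℂ (starRingEnd ℂ (ℓ' (e m)))
  rw [starRingEnd_self_apply]

/-- **A conjugate-linear bijection preserves finite-dimensionality** (a finite spanning set is carried to one, ★ `Submodule.FG.map` for
semilinear maps). [folklore] -/
theorem finiteDimensional_of_conjSemilinear (e : M ≃ₛₗ[starRingEnd ℂ] M') [FiniteDimensional ℂ M] :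
    FiniteDimensional ℂ M' := by
  have h : (⊤ : Submodule ℂ M').FG := by
    have hfg := (Module.Finite.fg_top (R := ℂ) (M := M)).map (e : M →ₛₗ[starRingEnd ℂ] M')
    rwa [Submodule.map_top, LinearMap.range_eq_top.mpr e.surjective] at hfg
  exact Module.finite_def.mpr h

/-- The span of the image of a set under a conjugate-linear bijection is finite-dimensional if the span of the set is. [folklore] -/
theorem finiteDimensional_span_image_of_conjSemilinear (e : M ≃ₛₗ[starRingEnd ℂ] M') (s : Set M)
    [FiniteDimensional ℂ (Submodule.span ℂ s)] : FiniteDimensional ℂ (Submodule.span ℂ (e '' s)) := by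
  have hfg : (Submodule.span ℂ s).FG := Module.Finite.iff_fg.mp inferInstance
  have h := hfg.map (e : M →ₛₗ[starRingEnd ℂ] M')
  rw [Submodule.map_span] at h
  exact Module.Finite.iff_fg.mpr h

end Algebra

variable {A : Type*} [NormedCommRing A] [NormedAlgebra ℝ A] [NormedAlgebra ℚ A] [CompleteSpace A]
  [StarRing A] {N : Type*} [Fintype N] [DecidableEq N] (G : RealMatrixGroup A N)

/-! ## §1 The `(𝔤, K)` axioms pass along a conjugate-linear equivariant bijection -/

section Transport

variable {M M' : Type*} [AddCommGroup M] [Module ℂ M] [AddCommGroup M'] [Module ℂ M']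
  {ρK : Representation ℂ G.maximalCompact M} {ρ𝔤 : G.lie →ₗ⁅ℝ⁆ Module.End ℂ M}
  {ρK' : Representation ℂ G.maximalCompact M'} {ρ𝔤' : G.lie →ₗ⁅ℝ⁆ Module.End ℂ M'}
  (e : M ≃ₛₗ[starRingEnd ℂ] M')
  (heK : ∀ (k : G.maximalCompact) (m : M), ρK' k (e m) = e (ρK k m))
  (he𝔤 : ∀ (X : G.lie) (m : M), ρ𝔤' X (e m) = e (ρ𝔤 X m))

include heK in
/-- The `K`-orbit of `e m` is the image of the `K`-orbit of `m`. [folklore] -/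
theorem range_orbit_eq_image_of_conjSemilinear (m : M) :
    (Set.range fun k : G.maximalCompact => ρK' k (e m)) = e '' Set.range fun k : G.maximalCompact => ρK k m := by
  ext x
  simp only [Set.mem_range, Set.mem_image, exists_exists_eq_and, heK]

include heK he𝔤 in
/-- **The `(𝔤, K)` axioms pass to the conjugate**: if `(ρK, ρ𝔤)` is a `(𝔤, K)`-module and `e` a conjugate-linear bijection intertwining
`(ρK, ρ𝔤)` with `(ρK', ρ𝔤')`, then `(ρK', ρ𝔤')` is a `(𝔤, K)`-module. [cite: KnappVogan1995, §VI.2] [cite: BorelWallach2000, 0 §2.5] -/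
theorem isGKModule_of_conjSemilinear [StarModule ℝ A] [ContinuousStar A] (hV : IsGKModule G ρK ρ𝔤) :
    IsGKModule G ρK' ρ𝔤' where
  kFinite m' := by
    obtain ⟨m, rfl⟩ := e.surjective m'
    haveI := hV.kFinite m
    rw [range_orbit_eq_image_of_conjSemilinear G e heK m]
    exact finiteDimensional_span_image_of_conjSemilinear e _
  weaklyContinuous m' ℓ' := by
    obtain ⟨m, rfl⟩ := e.surjective m'
    obtain ⟨ℓ, hℓ⟩ := exists_dual_conjSemilinear e ℓ'
    have h : (fun k : G.maximalCompact => ℓ' (ρK' k (e m))) = fun k => starRingEnd ℂ (ℓ (ρK k m)) := by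
      funext k
      rw [heK, hℓ]
    rw [h]
    exact Complex.continuous_conj.comp (hV.weaklyContinuous m ℓ)
  ad_compat k X := by
    refine LinearMap.ext fun m' => ?_
    obtain ⟨m, rfl⟩ := e.surjective m'
    have h := LinearMap.congr_fun (hV.ad_compat k X) m
    simp only [LinearMap.coe_comp, Function.comp_apply] at h ⊢
    rw [heK, he𝔤, heK, h, he𝔤]
  hasWeakDeriv X m' ℓ' := by
    obtain ⟨m, rfl⟩ := e.surjective m'
    obtain ⟨ℓ, hℓ⟩ := exists_dual_conjSemilinear e ℓ'
    have h1 : (fun t : ℝ => ℓ' (ρK' (G.expK (t • X)) (e m))) = fun t => star (ℓ (ρK (G.expK (t • X)) m)) := by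
      funext t
      rw [heK, hℓ, starRingEnd_apply]
    have h2 : ℓ' (ρ𝔤' (LieSubalgebra.inclusion G.compactLie_le_lie X) (e m)) =
        star (ℓ (ρ𝔤 (LieSubalgebra.inclusion G.compactLie_le_lie X) m)) := by
      rw [he𝔤, hℓ, starRingEnd_apply]
    rw [h1, h2]
    exact (hV.hasWeakDeriv X m ℓ).star

/-! ## §2 `(𝔤, K)`-submodules and irreducibility -/

include heK he𝔤 in
/-- The preimage under `e` of a `(𝔤, K)`-submodule of `M'` is a `(𝔤, K)`-submodule of `M`. [cite: KnappVogan1995, §VI.2] -/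
theorem isGKSubmodule_comap_conjSemilinear {U' : Submodule ℂ M'} (hU' : IsGKSubmodule ρK' ρ𝔤' U') :
    IsGKSubmodule ρK ρ𝔤 (U'.comap (e : M →ₛₗ[starRingEnd ℂ] M')) := by
  refine ⟨fun k m hm => ?_, fun X m hm => ?_⟩
  · have h := hU'.1 k (e m) hm
    rw [heK] at h
    exact h
  · have h := hU'.2 X (e m) hm
    rw [he𝔤] at h
    exact h

include heK he𝔤 in
/-- **Irreducibility passes to the conjugate.** [cite: KnappVogan1995, §VI.2] -/
theorem isIrreducibleGK_of_conjSemilinear (h : IsIrreducibleGK ρK ρ𝔤) : IsIrreducibleGK ρK' ρ𝔤' := by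
  refine ⟨?_, fun U' hU' => ?_⟩
  · haveI := h.nontrivial
    exact e.symm.toEquiv.nontrivial
  · have hU : U' = (U'.comap (e : M →ₛₗ[starRingEnd ℂ] M')).map (e : M →ₛₗ[starRingEnd ℂ] M') :=
      (Submodule.map_comap_eq_of_surjective e.surjective U').symm
    rcases h.eq_bot_or_eq_top (isGKSubmodule_comap_conjSemilinear G e heK he𝔤 hU') with hb | ht
    · left
      rw [hU, hb, Submodule.map_bot]
    · right
      rw [hU, ht, Submodule.map_top, LinearMap.range_eq_top.mpr e.surjective]

/-! ## §3 Admissibility -/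

include heK in
/-- **Admissibility passes to the conjugate**: `Hom_K(τ, ρK')` embeds real-linearly into `Hom_K(τ̄, ρK)` (`f ↦ e⁻¹ ∘ f ∘ toConj⁻¹`), which
is finite-dimensional for every irreducible finite-dimensional `τ` since `τ̄ = repConj τ` is again irreducible finite-dimensional.
[cite: KnappVogan1995, §I.3 (admissible), §VI.2] -/
theorem isAdmissibleGK_of_conjSemilinear (h : IsAdmissibleGK ρK) : IsAdmissibleGK ρK' := by
  intro W _ _ _ τ hτ
  haveI : FiniteDimensional ℂ (ConjVec W) := finiteDimensional_of_conjSemilinear (toConj (V := W))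
  have hτ' : (repConj τ).IsIrreducible := (isIrreducible_repConj_iff τ).mpr hτ
  haveI hfd : FiniteDimensional ℂ ((repConj τ).IntertwiningMap ρK) := h (ConjVec W) (repConj τ) hτ'
  -- `e⁻¹` intertwines `ρK'` with `ρK`
  have heK' : ∀ (k : G.maximalCompact) (y : M'), e.symm (ρK' k y) = ρK k (e.symm y) := by
    intro k y
    obtain ⟨m, rfl⟩ := e.surjective y
    rw [heK, LinearEquiv.symm_apply_apply, LinearEquiv.symm_apply_apply]
  -- the complex-linear map `e⁻¹ ∘ f ∘ toConj⁻¹ : W̄ → M` attached to `f : W → M'`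
  let L : τ.IntertwiningMap ρK' → (ConjVec W →ₗ[ℂ] M) := fun f =>
    { toFun := fun w => e.symm (f ((toConj (V := W)).symm w))
      map_add' := fun x y => by simp only [map_add]
      map_smul' := fun c w => by
        simp only [LinearEquiv.map_smulₛₗ, map_smul, starRingEnd_self_apply, RingHom.id_apply] }
  have hL : ∀ (f : τ.IntertwiningMap ρK') (w : ConjVec W), L f w = e.symm (f ((toConj (V := W)).symm w)) := fun f w => rfl
  have hLint : ∀ (f : τ.IntertwiningMap ρK') (k : G.maximalCompact) (w : ConjVec W),
      L f (repConj τ k w) = ρK k (L f w) := by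
    intro f k w
    rw [hL, hL, repConj_apply, LinearEquiv.symm_apply_apply, f.isIntertwining, heK']
  -- the induced REAL-linear map of intertwiner spaces
  let F : τ.IntertwiningMap ρK' →ₗ[ℝ] (repConj τ).IntertwiningMap ρK :=
    { toFun := fun f => (L f).intertwiningMap_of_isIntertwiningMap _ _ (hLint f)
      map_add' := fun f g => by
        refine Representation.IntertwiningMap.ext (LinearMap.ext fun w => ?_)
        change L (f + g) w = L f w + L g w
        rw [hL, hL, hL, Representation.IntertwiningMap.coe_add, Pi.add_apply, map_add]
      map_smul' := fun r f => by
        refine Representation.IntertwiningMap.ext (LinearMap.ext fun w => ?_)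
        change L (r • f) w = r • L f w
        rw [hL, hL, ← Complex.coe_smul, ← Complex.coe_smul, Representation.IntertwiningMap.coe_smul, Pi.smul_apply,
          LinearEquiv.map_smulₛₗ, Complex.conj_ofReal] }
  have hF : Function.Injective F := by
    intro f g hfg
    refine Representation.IntertwiningMap.ext (LinearMap.ext fun w => ?_)
    have h1 : L f (toConj w) = L g (toConj w) := by
      have := congrArg (fun φ : (repConj τ).IntertwiningMap ρK => φ (toConj w)) hfg
      exact this
    rw [hL, hL, LinearEquiv.symm_apply_apply] at h1
    exact e.symm.injective h1
  haveI : FiniteDimensional ℝ (τ.IntertwiningMap ρK') := FiniteDimensional.of_injective F hF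
  exact Module.Finite.of_restrictScalars_finite ℝ ℂ (τ.IntertwiningMap ρK')

end Transport

/-! ## §4 The conjugate `(𝔤, K)`-module `V̄ = ConjVec V` -/

section ConjVecInstances

variable {M : Type*} [AddCommGroup M] [Module ℂ M]
  {ρK : Representation ℂ G.maximalCompact M} {ρ𝔤 : G.lie →ₗ⁅ℝ⁆ Module.End ℂ M}

omit G in
/-- `V̄` is finite-dimensional when `V` is. [folklore] -/
theorem conjVec_finiteDimensional [FiniteDimensional ℂ M] : FiniteDimensional ℂ (ConjVec M) :=
  finiteDimensional_of_conjSemilinear (toConj (V := M))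

/-- **`V̄ = (ConjVec V, repConj ρK, conjRep ρ𝔤)` is a `(𝔤, K)`-module when `V` is.** [cite: KnappVogan1995, §VI.2] [cite: BorelWallach2000, 0 §2.5] -/
theorem isGKModule_repConj [StarModule ℝ A] [ContinuousStar A] (hV : IsGKModule G ρK ρ𝔤) :
    IsGKModule G (repConj ρK) (conjRep ρ𝔤) :=
  isGKModule_of_conjSemilinear G (toConj (V := M)) (fun _ _ => rfl) (fun _ _ => rfl) hV

/-- **`V̄` is irreducible when `V` is.** [cite: KnappVogan1995, §VI.2] -/
theorem isIrreducibleGK_repConj (h : IsIrreducibleGK ρK ρ𝔤) : IsIrreducibleGK (repConj ρK) (conjRep ρ𝔤) :=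
  isIrreducibleGK_of_conjSemilinear G (toConj (V := M)) (fun _ _ => rfl) (fun _ _ => rfl) h

/-- **`V̄` is admissible when `V` is.** [cite: KnappVogan1995, §I.3, §VI.2] -/
theorem isAdmissibleGK_repConj (h : IsAdmissibleGK ρK) : IsAdmissibleGK (repConj ρK) :=
  isAdmissibleGK_of_conjSemilinear G (toConj (V := M)) (fun _ _ => rfl) h

end ConjVecInstances

end Summit.HodgeConjecture.HodgeConjecture.Cruxes.H413.F0P3GKModuleConjVec
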